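import Summits.Ventures.CertifiedManyBodySolver.Downfold.EmeryOrbitalWeight
import HarnessLib

/-!
# Holes live in the antibonding band only; the oxygen weight is the charge-transfer Hellmann–Feynman slope

Venture CertifiedManyBodySolver, cell `pub/hubbard-downfold` (stage S1; INFLATION-RULES-3to1-B §B.81 THE ORBITAL PARTITION OF THE
HOLES OVER THE ZONE), seat hubbard-downfold-mod-4 (technique B, g33); namespace `Summit.Ventures.CertifiedManyBodySolver.Downfold.Emery`.
Everything PROVED (0 sorry). WHAT THIS IS NOT: a statement about any material; `U = 0` one-body kinematics of the σ (d–p_x–p_y +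
t_pp, t_pp′) model (electron picture, `ε_d = 0`, `ε_p = −Δ`).

* §1 **THE POSITIVE BAND ENERGY IS UNIQUE** (`pos_root_eq_abBand`): for `Δ, t_pp, t_pp′ ≥ 0`, `x, y ≥ 0`, every root `ε > 0` of the
  secular cubic `charCubic(x, y, ·)` IS the antibonding energy `abBand(x, y)` — the two other bands lie at `ε ≤ 0` at every k. Proof
  without spectral theory: synthetic division `charCubic(t) = (t − r)·Q(t)` at the top root `r` (`charCubic_factor_topRoot`), so at a
  second root `ε < r` the energy derivative is `(ε − r)·(2ε + cubA + r) < 0` (`dcharCubic_at_other_root`), contradicting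
  `∂_ε charCubic = minorD + minorX + minorY ≥ 0` at any positive root (`EmeryOrbitalWeight`). CONSEQUENCE (`holes_antibonding_only`):
  at any Fermi energy `ε_F ≥ 0` … every Bloch state strictly above `ε_F` is an antibonding state — the hole contents of the σ model are
  integrals over the antibonding band alone (the objects `dHole`, `pHole`, `nHole` of `EmeryZoneOrbitalContent`).
* §2 **THE OXYGEN WEIGHT IS THE CHARGE-TRANSFER SLOPE** (Hellmann–Feynman for `Δ`): `∂_Δ charCubic = minorX + minorY`
  (exact Taylor identity `charCubic_shift_Delta`), hence at a band energy with `∂_ε charCubic ≠ 0` the implicit slope is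
  `dε/dΔ = −(minorX + minorY)/∂_ε charCubic = −(1 − w_d)` (`one_sub_dWeight_eq`, `ctSlope_eq_neg_pWeight`): lowering the oxygen
  level by `dΔ` lowers every band state by its OXYGEN weight `w_p = 1 − w_d` — the zone-integrated O hole content `pHole` is (minus) the
  `Δ`-derivative of the holes' band energy at fixed occupation (prose).

Sources: three-band model [HybertsenSchluterChristensen1989, Eq. (1)]; Hellmann–Feynman [folklore]; [AndersenEtAl1995, §6].
-/

noncomputable section

namespace Summit.Ventures.CertifiedManyBodySolver.Downfold.Emery

open Real

/-! ## §1 The positive root of the secular cubic is unique -/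

/-- Synthetic division at a root `r`: `charCubic(t) = (t − r)·(t² + (r + cubA)t + (r² + cubA·r + cubB))`. [folklore] -/
theorem charCubic_factor_root {Δ tpd tpp c x y r : ℝ} (hr : charCubic Δ tpd tpp c x y r = 0) (t : ℝ) :
    charCubic Δ tpd tpp c x y t =
      (t - r) * (t ^ 2 + (r + cubA Δ c x y) * t + (r ^ 2 + cubA Δ c x y * r + cubB Δ tpd tpp c x y)) := by
  have h1 := charCubic_eq_monicCubic Δ tpd tpp c x y t
  have h2 := charCubic_eq_monicCubic Δ tpd tpp c x y r
  rw [hr] at h2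
  rw [h1]
  unfold monicCubic at h2 ⊢
  have : cubD Δ tpd tpp c x y = -(r ^ 3 + cubA Δ c x y * r ^ 2 + cubB Δ tpd tpp c x y * r) := by linarith
  rw [this]; ring

/-- At a root `ε ≠ r` of the cubic (with `r` a root), the quadratic cofactor vanishes and
`∂_ε charCubic(ε) = (ε − r)(2ε + cubA + r)`. [folklore] -/
theorem dcharCubic_at_other_root {Δ tpd tpp c x y r ε : ℝ} (hr : charCubic Δ tpd tpp c x y r = 0)
    (hε : charCubic Δ tpd tpp c x y ε = 0) (hne : ε ≠ r) :
    dcharCubic Δ tpd tpp c x y ε = (ε - r) * (2 * ε + cubA Δ c x y + r) := by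
  have hQ : ε ^ 2 + (r + cubA Δ c x y) * ε + (r ^ 2 + cubA Δ c x y * r + cubB Δ tpd tpp c x y) = 0 := by
    have h := charCubic_factor_root hr ε
    rw [hε] at h
    rcases mul_eq_zero.mp h.symm with h0 | h0
    · exact absurd (sub_eq_zero.mp h0) hne
    · exact h0
  -- the energy derivative in monic form: 3ε² + 2·cubA·ε + cubB
  have hd : dcharCubic Δ tpd tpp c x y ε = 3 * ε ^ 2 + 2 * cubA Δ c x y * ε + cubB Δ tpd tpp c x y := by
    unfold dcharCubic dcA dfsD dfsN cubA cubB; ring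
  rw [hd]; nlinarith [hQ]

/-- **THE POSITIVE ROOT IS THE ANTIBONDING ENERGY**: for `Δ, t_pp, t_pp′ ≥ 0`, `x, y ≥ 0`, a root `ε > 0` of `charCubic(x, y, ·)` equals
`abBand(x, y)` — the bonding and non-bonding bands never rise above `ε_d = 0`. [folklore] -/
theorem pos_root_eq_abBand {Δ tpd tpp c x y ε : ℝ} (hΔ : 0 ≤ Δ) (hc : 0 ≤ c) (htpp : 0 ≤ tpp) (hx : 0 ≤ x) (hy : 0 ≤ y)
    (hε : 0 < ε) (hP : charCubic Δ tpd tpp c x y ε = 0) : ε = abBand Δ tpd tpp c x y := by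
  have hle : ε ≤ abBand Δ tpd tpp c x y := le_abBand_of_charCubic_eq_zero hP
  by_contra hne
  have hlt : ε < abBand Δ tpd tpp c x y := lt_of_le_of_ne hle hne
  have hr := charCubic_abBand Δ tpd tpp c x y
  have hd := dcharCubic_at_other_root hr hP hne
  have hA : 0 ≤ cubA Δ c x y := by unfold cubA; positivity
  have hneg : dcharCubic Δ tpd tpp c x y ε < 0 := by
    rw [hd]; exact mul_neg_of_neg_of_pos (by linarith) (by linarith)
  -- but the minors are non-negative at a positive root
  have hD := minorD_nonneg_of_contour hΔ hc htpp hx hy hε hP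
  have hX := minorX_nonneg_of_contour hΔ hc htpp hx hy hε hP
  have hY := minorY_nonneg_of_contour hΔ hc htpp hx hy hε hP
  have hpos : 0 ≤ dcharCubic Δ tpd tpp c x y ε := by rw [← sum_minors_eq_dcharCubic]; linarith
  linarith

/-- **HOLES LIVE IN THE ANTIBONDING BAND ONLY** (k-space form): for `Δ, t_pp, t_pp′ ≥ 0`, every eigen-energy `ε > 0` of the Bloch
matrix `bloch4` at `(sx, sy)` is the antibonding energy `abBand(sx², sy²)`; in particular at any Fermi energy `ε_F ≥ 0` every empty
Bloch state is an antibonding state. [folklore] -/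
theorem holes_antibonding_only {Δ tpd tpp c sx sy ε : ℝ} (hΔ : 0 ≤ Δ) (hc : 0 ≤ c) (htpp : 0 ≤ tpp) (hε : 0 < ε)
    (h : (bloch4 Δ tpd tpp c sx sy - ε • (1 : Matrix (Fin 3) (Fin 3) ℝ)).det = 0) :
    ε = abBand Δ tpd tpp c (sx ^ 2) (sy ^ 2) := by
  rw [det_bloch4_sub_eq_neg_charCubic, neg_eq_zero] at h
  exact pos_root_eq_abBand hΔ hc htpp (sq_nonneg _) (sq_nonneg _) hε h

/-! ## §2 The oxygen weight as the charge-transfer Hellmann–Feynman slope -/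

/-- EXACT TAYLOR IDENTITY IN THE CHARGE-TRANSFER ENERGY: `charCubic(Δ + δ) = charCubic(Δ) + δ·(minorX + minorY) + δ²·ε` — the
first-order coefficient `∂_Δ charCubic = minorX + minorY` is the sum of the principal minors complementary to the two oxygen entries
(no analysis needed). [folklore] -/
theorem charCubic_shift_Delta (Δ tpd tpp c x y ε δ : ℝ) :
    charCubic (Δ + δ) tpd tpp c x y ε = charCubic Δ tpd tpp c x y ε + δ * (minorX Δ tpd c y ε + minorY Δ tpd c x ε) + δ ^ 2 * ε := by
  unfold charCubic minorX minorY
  ring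

/-- The oxygen weight of a band state: `1 − w_d = (minorX + minorY)/∂_ε charCubic` (where `∂_ε charCubic ≠ 0`). [folklore] -/
theorem one_sub_dWeight_eq {Δ tpd tpp c x y ε : ℝ} (hW : dcharCubic Δ tpd tpp c x y ε ≠ 0) :
    1 - dWeight Δ tpd tpp c x y ε = (minorX Δ tpd c y ε + minorY Δ tpd c x ε) / dcharCubic Δ tpd tpp c x y ε := by
  rw [dWeight_eq_div_dcharCubic, ← sum_minors_eq_dcharCubic] at *
  field_simp
  ring

/-- **THE CHARGE-TRANSFER SLOPE IS MINUS THE OXYGEN WEIGHT** (Hellmann–Feynman): the implicit-function slope of a band energy with respect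
to `Δ`, `−∂_Δ charCubic/∂_ε charCubic`, equals `−(1 − w_d)`. Lowering the oxygen level by `dΔ` lowers the state by `w_p·dΔ`. [folklore] -/
theorem ctSlope_eq_neg_pWeight {Δ tpd tpp c x y ε : ℝ} (hW : dcharCubic Δ tpd tpp c x y ε ≠ 0) :
    -(minorX Δ tpd c y ε + minorY Δ tpd c x ε) / dcharCubic Δ tpd tpp c x y ε = -(1 - dWeight Δ tpd tpp c x y ε) := by
  rw [one_sub_dWeight_eq hW, neg_div]

/-- On the antibonding sheet in the cuprate regime the charge-transfer slope lies in `[−1, 0]`: a band state cannot fall faster than the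
oxygen level. [folklore] -/
theorem ctSlope_mem_Icc {Δ tpd tpp c x y : ℝ} (hΔ : 0 ≤ Δ) (hc : 0 ≤ c) (htpp : 0 ≤ tpp) (hx : 0 ≤ x) (hy : 0 ≤ y)
    (hε : 0 < abBand Δ tpd tpp c x y) (hW : dcharCubic Δ tpd tpp c x y (abBand Δ tpd tpp c x y) ≠ 0) :
    -(minorX Δ tpd c y (abBand Δ tpd tpp c x y) + minorY Δ tpd c x (abBand Δ tpd tpp c x y)) /
        dcharCubic Δ tpd tpp c x y (abBand Δ tpd tpp c x y) ∈ Set.Icc (-1 : ℝ) 0 := by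
  rw [ctSlope_eq_neg_pWeight hW]
  have h0 := dWeight_nonneg hΔ hc htpp hx hy hε
  have h1 := dWeight_le_one hΔ hc htpp hx hy hε
  constructor <;> linarith

end Summit.Ventures.CertifiedManyBodySolver.Downfold.Emery
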